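import Summits.Parity.BatemanHorn.Theorems.SoloInformedTrapezoidUniform
import Summits.Parity.BatemanHorn.Theorems.SoloInformedHooleyShiftAssembly
import Summits.Parity.BatemanHorn.Theorems.SoloInformedTrapezoidReduction

/-!
# The trapezoid method: dyadic summation over the modulus range and the exponent bookkeeping

Ledger: this work (soloist programme `solo-Parity-informed`, the `d ≥ 3` rung below the parity wall).

Preparations for summing the uniform block bound of `SoloInformedTrapezoidUniform` over the dyadic blocks of the
modulus range `X₁ < e ≤ E*` of the trapezoid form:
* `trapKernel_eq_zero_of_large`: the kernels `K_e` vanish for `e > U₀ = e^{Δ + B/2} X₁^{d/2}`;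
* `norm_sum_Ioc_le_dyadic`, `norm_trapSum_le_dyadic`: only `log₂⌊U₀⌋ + 1` dyadic blocks occur, each bounded by
  the block bound taken at `E = U₀` (at `E = X₁` for the monomial with the negative exponent `1 − η − 2/d`);
* `trapBmax_le`, `natLog_le_of_le_pow`, `trapKappa_pos`, `one_add_log_sq_le`, `trapFinal_le`: the real
  bookkeeping turning the four monomials at `U₀ ≍ X₁^{d/2}` into `X₁^{2−κ} + D·X₁^{1−κ}` times powers of
  `log X₁`, with `κ = min(1 − (d/2)(1−η), 2 − (d/2)(2−θ), η + 2/d − 1) > 0` exactly when `η > 1 − 2/d` and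
  `θ > 2 − 4/d`, and the final comparison with `ε·D·X₀ log X₀`.
The cancellation theorem itself is in `SoloInformedTrapezoidCancellation`.
-/

namespace Summit.Parity.BatemanHorn.Theorems

open Finset Polynomial
open Literature.NumberTheory.Sieve (polyRootCountMod)

/-! ### Dyadic summation and truncation of the modulus range -/

/-- Dyadic summation: a bound `B` for every block `(E, E'] ⊆ (E₀, T]`, `E' ≤ 2E`, gives `J·B` on `(E, t]` for
`t ≤ min(2^J E, T)`. [folklore] -/
theorem norm_sum_Ioc_le_dyadic (f : ℕ → ℂ) {E₀ T : ℕ} {B : ℝ} (hB0 : 0 ≤ B)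
    (hB : ∀ E E' : ℕ, E₀ ≤ E → E ≤ E' → E' ≤ 2 * E → E' ≤ T → ‖∑ e ∈ Ioc E E', f e‖ ≤ B) :
    ∀ J E t : ℕ, E₀ ≤ E → t ≤ 2 ^ J * E → t ≤ T → ‖∑ e ∈ Ioc E t, f e‖ ≤ J * B := by
  intro J
  induction J with
  | zero =>
    intro E t _ ht _
    rw [pow_zero, one_mul] at ht
    rw [Finset.Ioc_eq_empty (by omega), sum_empty, norm_zero, Nat.cast_zero, zero_mul]
  | succ J ih =>
    intro E t hE ht htT
    push_cast
    by_cases h2 : t ≤ 2 * E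
    · by_cases hEt : E ≤ t
      · have := hB E t hE hEt h2 htT
        nlinarith
      · rw [Finset.Ioc_eq_empty (by omega), sum_empty, norm_zero]
        nlinarith
    · rw [not_le] at h2
      rw [← sum_Ioc_consecutive f (show E ≤ 2 * E by omega) h2.le]
      have h1 := hB E (2 * E) hE (by omega) le_rfl (by omega)
      have h3 := ih (2 * E) t (by omega) (by rw [pow_succ] at ht; linarith) htT
      calc ‖∑ e ∈ Ioc E (2 * E), f e + ∑ e ∈ Ioc (2 * E) t, f e‖
          ≤ ‖∑ e ∈ Ioc E (2 * E), f e‖ + ‖∑ e ∈ Ioc (2 * E) t, f e‖ := norm_add_le _ _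
        _ ≤ B + J * B := add_le_add h1 h3
        _ = (J + 1) * B := by ring

/-- Terms vanishing beyond `T` may be dropped: `∑_{a<e≤b} F(e) = ∑_{a<e≤min(b,T)} F(e)`. [folklore] -/
theorem sum_Ioc_eq_sum_Ioc_min {M : Type*} [AddCommMonoid M] (F : ℕ → M) {a b T : ℕ}
    (hT : ∀ e : ℕ, T < e → F e = 0) : ∑ e ∈ Ioc a b, F e = ∑ e ∈ Ioc a (min b T), F e := by
  symm
  apply sum_subset
  · intro e he
    simp only [mem_Ioc] at he ⊢
    exact ⟨he.1, he.2.trans (min_le_left _ _)⟩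
  · intro e he hne
    simp only [mem_Ioc, not_and, not_le] at he hne
    exact hT e (by have := hne he.1; omega)

/-- `√|g(m)| ≤ e^{B/2} m^{d/2}` from `|log|g(m)| − d log m| ≤ B`. [this work] -/
theorem sqrt_natAbs_eval_le {g : ℤ[X]} {B : ℝ}
    (hB : ∀ n : ℕ, 1 ≤ n → |Real.log ((g.eval (n : ℤ)).natAbs : ℝ) - g.natDegree * Real.log n| ≤ B)
    {m : ℕ} (hm : 1 ≤ m) (hz : g.eval (m : ℤ) ≠ 0) :
    Real.sqrt ((g.eval (m : ℤ)).natAbs : ℝ) ≤ Real.exp (B / 2) * (m : ℝ) ^ ((g.natDegree : ℝ) / 2) := by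
  set N : ℝ := ((g.eval (m : ℤ)).natAbs : ℝ) with hN
  have hN0 : 0 < N := by
    rw [hN]; exact_mod_cast Int.natAbs_pos.mpr hz
  have hm0 : (0 : ℝ) < m := by exact_mod_cast (show 0 < m by omega)
  have h1 := (abs_le.mp (hB m hm)).2
  rw [show Real.sqrt N = Real.exp (Real.log N / 2) by
      rw [Real.sqrt_eq_rpow, Real.rpow_def_of_pos hN0]; ring_nf,
    Real.rpow_def_of_pos hm0, ← Real.exp_add]
  exact Real.exp_le_exp.mpr (by linarith)

/-- The kernels vanish for large moduli: `K_e(h) = 0` for `e > e^Δ e^{B/2} X₁^{d/2}`, `X₁ = X₀ + D`.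
[this work] -/
theorem trapKernel_eq_zero_of_large (g : ℤ[X]) {Δ : ℝ} (hΔ : 0 < Δ) (hz : ∀ k : ℕ, g.eval (k : ℤ) ≠ 0)
    {B : ℝ}
    (hB : ∀ n : ℕ, 1 ≤ n → |Real.log ((g.eval (n : ℤ)).natAbs : ℝ) - g.natDegree * Real.log n| ≤ B)
    {X₀ D e : ℕ}
    (he : Real.exp Δ * Real.exp (B / 2) * (((X₀ + D : ℕ) : ℝ)) ^ ((g.natDegree : ℝ) / 2) < e) (h : ℤ) :
    trapKernel g Δ X₀ D e h = 0 := by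
  unfold trapKernel
  refine sum_eq_zero fun m hm => ?_
  have hm' := mem_Icc.mp hm
  have hzero : locWeight g Δ e m = 0 := by
    apply locWeight_eq_zero_of_sqrt_lt g hΔ (hz m)
    refine lt_of_le_of_lt ?_ he
    rw [mul_assoc]
    apply mul_le_mul_of_nonneg_left _ (Real.exp_pos Δ).le
    refine (sqrt_natAbs_eval_le hB hm'.1 (hz m)).trans ?_
    apply mul_le_mul_of_nonneg_left _ (Real.exp_pos _).le
    exact Real.rpow_le_rpow (Nat.cast_nonneg _) (by exact_mod_cast hm'.2) (by positivity)
  simp [hzero]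

/-! ### The trapezoid form on `(X₁, E*]`: truncation and dyadic summation -/

set_option maxHeartbeats 400000 in
/-- From a uniform four-monomial block bound on the blocks `(E, E'] ⊆ (X₁, ∞)`, `E' ≤ 2E`, to a bound for the whole
trapezoid form: only the moduli `e ≤ U₀` (`U₀ ≥ e^{Δ+B/2} X₁^{d/2}`, `U₀ ≥ X₁`) contribute, in at most
`log₂⌊U₀⌋ + 1` dyadic blocks, each bounded by the block bound at `E = U₀` (at `E = X₁` for the monomial with the
negative exponent `1 − η − 2/d`). [this work] -/
theorem norm_trapSum_le_dyadic (g : ℤ[X]) {Δ : ℝ} (hΔ : 0 < Δ) (hz : ∀ k : ℕ, g.eval (k : ℤ) ≠ 0) {B : ℝ}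
    (hB : ∀ n : ℕ, 1 ≤ n → |Real.log ((g.eval (n : ℤ)).natAbs : ℝ) - g.natDegree * Real.log n| ≤ B)
    {K θ η₁ : ℝ} (hK0 : 0 ≤ K) (ha₁ : 0 ≤ 1 - η₁) (ha₂ : 1 - η₁ - 2 / (g.natDegree : ℝ) ≤ 0)
    (ha₃ : 0 ≤ 2 - θ) (ha₄ : 0 ≤ 2 - θ - 2 / (g.natDegree : ℝ)) {X₀ D : ℕ}
    (hK : ∀ E E' : ℕ, X₀ + D ≤ E → E ≤ E' → E' ≤ 2 * E →
      ‖∑ e ∈ Ioc E E', 1 / (e : ℂ) * ∑ h ∈ Ico 1 e, trapKernel g Δ X₀ D e h * hooleySum g e h‖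
        ≤ K * ((2 + Real.log E) * ((X₀ + D : ℕ) * (E : ℝ) ^ (1 - η₁)
              + (X₀ + D : ℕ) * D * (E : ℝ) ^ (1 - η₁ - 2 / g.natDegree))
            + (E : ℝ) ^ (2 - θ) + D * (E : ℝ) ^ (2 - θ - 2 / g.natDegree)))
    (h1 : 1 ≤ X₀ + D) {U₀ : ℝ}
    (hU₀ : Real.exp Δ * Real.exp (B / 2) * ((X₀ + D : ℕ) : ℝ) ^ ((g.natDegree : ℝ) / 2) ≤ U₀)
    (hXU : ((X₀ + D : ℕ) : ℝ) ≤ U₀) :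
    ‖∑ e ∈ Ioc (X₀ + D) (trapOuter g (X₀ + D)),
        1 / (e : ℂ) * ∑ h ∈ Ico 1 e, trapKernel g Δ X₀ D e h * hooleySum g e h‖
      ≤ ((Nat.log 2 ⌊U₀⌋₊ : ℝ) + 1) * (K * ((2 + Real.log U₀) * ((X₀ + D : ℕ) * U₀ ^ (1 - η₁)
            + (X₀ + D : ℕ) * D * ((X₀ + D : ℕ) : ℝ) ^ (1 - η₁ - 2 / g.natDegree))
          + U₀ ^ (2 - θ) + D * U₀ ^ (2 - θ - 2 / g.natDegree))) := by
  set d : ℕ := g.natDegree with hd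
  set X₁ : ℕ := X₀ + D with hX₁
  set Xr : ℝ := ((X₁ : ℕ) : ℝ) with hXr
  have hXr1 : (1 : ℝ) ≤ Xr := by rw [hXr]; exact_mod_cast h1
  have hXr0 : 0 < Xr := by linarith
  have hU₀1 : 1 ≤ U₀ := hXr1.trans hXU
  set T : ℕ := ⌊U₀⌋₊ with hT
  have hXT : X₁ ≤ T := Nat.le_floor hXU
  set F : ℕ → ℂ := fun e => 1 / (e : ℂ) * ∑ h ∈ Ico 1 e, trapKernel g Δ X₀ D e h * hooleySum g e h
    with hF
  have hFzero : ∀ e : ℕ, T < e → F e = 0 := by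
    intro e he
    have heU : U₀ < e := by
      have h1 := Nat.lt_floor_add_one U₀
      have h2 : (((⌊U₀⌋₊ + 1 : ℕ)) : ℝ) ≤ e := by exact_mod_cast he
      push_cast at h2
      linarith
    have hK0 : ∀ h : ℤ, trapKernel g Δ X₀ D e h = 0 := fun h =>
      trapKernel_eq_zero_of_large g hΔ hz hB (lt_of_le_of_lt hU₀ heU) h
    simp only [hF, hK0, zero_mul, sum_const_zero, mul_zero]
  show ‖∑ e ∈ Ioc X₁ (trapOuter g X₁), F e‖ ≤ _
  rw [sum_Ioc_eq_sum_Ioc_min F hFzero]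
  set t : ℕ := min (trapOuter g X₁) T with ht
  have htT : t ≤ T := min_le_right _ _
  have hX₁t : X₁ ≤ t := le_min (by unfold trapOuter; exact le_max_left _ _) hXT
  have hlogU0 : 0 ≤ Real.log U₀ := Real.log_nonneg hU₀1
  set Bmax : ℝ := K * ((2 + Real.log U₀) * (Xr * U₀ ^ (1 - η₁) + Xr * D * Xr ^ (1 - η₁ - 2 / d))
      + U₀ ^ (2 - θ) + D * U₀ ^ (2 - θ - 2 / d)) with hBmax
  have hBmax0 : 0 ≤ Bmax := by positivity
  have hblocks : ∀ E E' : ℕ, X₁ ≤ E → E ≤ E' → E' ≤ 2 * E → E' ≤ t → ‖∑ e ∈ Ioc E E', F e‖ ≤ Bmax := by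
    intro E E' hE hEE' hE'2 hE't
    refine (hK E E' hE hEE' hE'2).trans ?_
    have hE0 : (0 : ℝ) < E := by exact_mod_cast (show 0 < E by omega)
    have hEU : (E : ℝ) ≤ U₀ := by
      have h1 : (E : ℝ) ≤ T := by exact_mod_cast (hEE'.trans (hE't.trans htT))
      exact h1.trans (Nat.floor_le (by linarith))
    have hXE : Xr ≤ E := by rw [hXr]; exact_mod_cast hE
    have i1 : Real.log E ≤ Real.log U₀ := Real.log_le_log hE0 hEU
    have i2 : (E : ℝ) ^ (1 - η₁) ≤ U₀ ^ (1 - η₁) := Real.rpow_le_rpow hE0.le hEU ha₁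
    have i3 : (E : ℝ) ^ (1 - η₁ - 2 / d) ≤ Xr ^ (1 - η₁ - 2 / d) :=
      Real.rpow_le_rpow_of_nonpos hXr0 hXE ha₂
    have i4 : (E : ℝ) ^ (2 - θ) ≤ U₀ ^ (2 - θ) := Real.rpow_le_rpow hE0.le hEU ha₃
    have i5 : (E : ℝ) ^ (2 - θ - 2 / d) ≤ U₀ ^ (2 - θ - 2 / d) := Real.rpow_le_rpow hE0.le hEU ha₄
    have j1 : Xr * (E : ℝ) ^ (1 - η₁) + Xr * D * (E : ℝ) ^ (1 - η₁ - 2 / d)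
        ≤ Xr * U₀ ^ (1 - η₁) + Xr * D * Xr ^ (1 - η₁ - 2 / d) :=
      add_le_add (mul_le_mul_of_nonneg_left i2 hXr0.le) (mul_le_mul_of_nonneg_left i3 (by positivity))
    have j2 : (2 + Real.log E) * (Xr * (E : ℝ) ^ (1 - η₁) + Xr * D * (E : ℝ) ^ (1 - η₁ - 2 / d))
        ≤ (2 + Real.log U₀) * (Xr * U₀ ^ (1 - η₁) + Xr * D * Xr ^ (1 - η₁ - 2 / d)) :=
      mul_le_mul (by linarith) j1 (by positivity) (by linarith)
    rw [hBmax]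
    exact mul_le_mul_of_nonneg_left (add_le_add (add_le_add j2 i4)
      (mul_le_mul_of_nonneg_left i5 (Nat.cast_nonneg D))) hK0
  set J : ℕ := Nat.log 2 t + 1 with hJ
  have htJ : t ≤ 2 ^ J * X₁ := by
    have h1 := Nat.lt_pow_succ_log_self Nat.one_lt_two t
    calc t ≤ 2 ^ J := h1.le
      _ ≤ 2 ^ J * X₁ := Nat.le_mul_of_pos_right _ (by omega)
  have hZ := norm_sum_Ioc_le_dyadic F hBmax0 hblocks J X₁ t le_rfl htJ le_rfl
  refine hZ.trans (mul_le_mul_of_nonneg_right ?_ hBmax0)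
  rw [hJ]; push_cast
  have h1 : (Nat.log 2 t : ℝ) ≤ Nat.log 2 T := by exact_mod_cast Nat.log_mono_right htT
  linarith

/-! ### The real bookkeeping: powers of `U₀ = K_U X₁^{d/2}` and the number of blocks -/

/-- The four monomials at `U₀ = K_U·X^{d/2}` in terms of `X^{2−κ}` and `D·X^{1−κ}`. [this work] -/
theorem trapBmax_le {K KU X D d θ η₁ κ : ℝ} (hK : 0 ≤ K) (hKU : 1 ≤ KU) (hX : 1 ≤ X) (hD : 0 ≤ D)
    (hd : 0 < d) (hη₁ : η₁ ≤ 1) (hθ : θ ≤ 1) (hθ0 : 0 ≤ θ) (h2d : 2 / d ≤ 1) (hκ0 : 0 ≤ κ)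
    (hκ₁ : κ ≤ 1 - d / 2 * (1 - η₁)) (hκ₂ : κ ≤ 2 - d / 2 * (2 - θ)) (hκ₃ : κ ≤ η₁ + 2 / d - 1) :
    K * ((2 + Real.log (KU * X ^ (d / 2))) * (X * (KU * X ^ (d / 2)) ^ (1 - η₁)
          + X * D * X ^ (1 - η₁ - 2 / d))
        + (KU * X ^ (d / 2)) ^ (2 - θ) + D * (KU * X ^ (d / 2)) ^ (2 - θ - 2 / d))
      ≤ K * KU ^ (2 : ℝ) * ((2 + Real.log KU + d / 2) * (1 + Real.log X) + 1)
          * (X ^ (2 - κ) + D * X ^ (1 - κ)) := by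
  have hX0 : 0 < X := by linarith
  have hd0 : d ≠ 0 := hd.ne'
  have h2d0 : 0 ≤ 2 / d := by positivity
  set U₀ : ℝ := KU * X ^ (d / 2) with hU₀
  set KU2 : ℝ := KU ^ (2 : ℝ) with hKU2
  have hKU21 : 1 ≤ KU2 := Real.one_le_rpow hKU (by norm_num)
  have hlogKU : 0 ≤ Real.log KU := Real.log_nonneg hKU
  have hlogX : 0 ≤ Real.log X := Real.log_nonneg hX
  set cL : ℝ := 2 + Real.log KU + d / 2 with hcL
  set L₁ : ℝ := 1 + Real.log X with hL₁
  set P₁ : ℝ := X ^ (1 - κ) with hP₁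
  set P₂ : ℝ := X ^ (2 - κ) with hP₂
  have hP₁0 : 0 ≤ P₁ := by positivity
  have hlogU : Real.log U₀ = Real.log KU + d / 2 * Real.log X := by
    rw [hU₀, Real.log_mul (by positivity) (by positivity), Real.log_rpow hX0]
  have p1 : 2 + Real.log U₀ ≤ cL * L₁ := by
    rw [hlogU, hcL, hL₁]
    nlinarith [mul_nonneg hlogKU hlogX, mul_nonneg hd.le hlogX]
  have hUpow : ∀ s : ℝ, 0 ≤ s → s ≤ 2 → U₀ ^ s ≤ KU2 * X ^ (d / 2 * s) := by
    intro s hs hs2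
    rw [hU₀, Real.mul_rpow (by positivity) (by positivity), ← Real.rpow_mul hX0.le]
    exact mul_le_mul_of_nonneg_right (Real.rpow_le_rpow_of_exponent_le hKU hs2) (by positivity)
  have p2 : U₀ ^ (1 - η₁) ≤ KU2 * P₁ := by
    refine (hUpow _ (by linarith) (by linarith)).trans (mul_le_mul_of_nonneg_left ?_ (by positivity))
    exact Real.rpow_le_rpow_of_exponent_le hX (by linarith)
  have p3 : U₀ ^ (2 - θ) ≤ KU2 * P₂ := by
    refine (hUpow _ (by linarith) (by linarith)).trans (mul_le_mul_of_nonneg_left ?_ (by positivity))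
    exact Real.rpow_le_rpow_of_exponent_le hX (by linarith)
  have p4 : U₀ ^ (2 - θ - 2 / d) ≤ KU2 * P₁ := by
    refine (hUpow _ (by linarith) (by linarith)).trans (mul_le_mul_of_nonneg_left ?_ (by positivity))
    have : d / 2 * (2 - θ - 2 / d) = d / 2 * (2 - θ) - 1 := by field_simp
    rw [this]
    exact Real.rpow_le_rpow_of_exponent_le hX (by linarith)
  have p5 : X * X ^ (1 - η₁ - 2 / d) ≤ P₁ := by
    rw [show X * X ^ (1 - η₁ - 2 / d) = X ^ ((1 : ℝ) + (1 - η₁ - 2 / d)) by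
      rw [Real.rpow_add hX0, Real.rpow_one]]
    exact Real.rpow_le_rpow_of_exponent_le hX (by linarith)
  have p6 : X * P₁ = P₂ := by
    rw [hP₁, hP₂, show (2 : ℝ) - κ = 1 + (1 - κ) by ring, Real.rpow_add hX0, Real.rpow_one]
  have q1 : X * U₀ ^ (1 - η₁) + X * D * X ^ (1 - η₁ - 2 / d) ≤ KU2 * (P₂ + D * P₁) := by
    have h1 := mul_le_mul_of_nonneg_left p2 hX0.le
    have h2 := mul_le_mul_of_nonneg_left p5 hD
    have h3 : D * P₁ ≤ KU2 * (D * P₁) := le_mul_of_one_le_left (by positivity) hKU21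
    calc X * U₀ ^ (1 - η₁) + X * D * X ^ (1 - η₁ - 2 / d) ≤ X * (KU2 * P₁) + D * P₁ := by linarith
      _ = KU2 * P₂ + D * P₁ := by rw [← p6]; ring
      _ ≤ KU2 * (P₂ + D * P₁) := by linarith
  have q2 : (2 + Real.log U₀) * (X * U₀ ^ (1 - η₁) + X * D * X ^ (1 - η₁ - 2 / d))
      ≤ cL * L₁ * (KU2 * (P₂ + D * P₁)) :=
    mul_le_mul p1 q1 (by positivity) (by positivity)
  have q3 : U₀ ^ (2 - θ) + D * U₀ ^ (2 - θ - 2 / d) ≤ KU2 * (P₂ + D * P₁) := by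
    have := mul_le_mul_of_nonneg_left p4 hD
    linarith [p3]
  calc K * ((2 + Real.log U₀) * (X * U₀ ^ (1 - η₁) + X * D * X ^ (1 - η₁ - 2 / d))
        + U₀ ^ (2 - θ) + D * U₀ ^ (2 - θ - 2 / d))
      ≤ K * (cL * L₁ * (KU2 * (P₂ + D * P₁)) + KU2 * (P₂ + D * P₁)) :=
        mul_le_mul_of_nonneg_left (by linarith [q2, q3]) hK
    _ = K * KU2 * (cL * L₁ + 1) * (P₂ + D * P₁) := by ring

/-- The number of dyadic blocks: `log₂ T + 1 ≤ (2(2 + log K_U + d/2) + 1)(1 + log X)` for `T ≤ K_U X^{d/2}`.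
[this work] -/
theorem natLog_le_of_le_pow {KU X d : ℝ} (hKU : 1 ≤ KU) (hX : 1 ≤ X) (hd : 0 ≤ d) {T : ℕ}
    (hT : (T : ℝ) ≤ KU * X ^ (d / 2)) :
    (Nat.log 2 T : ℝ) + 1 ≤ (2 * (2 + Real.log KU + d / 2) + 1) * (1 + Real.log X) := by
  have hX0 : 0 < X := by linarith
  have hlogKU : 0 ≤ Real.log KU := Real.log_nonneg hKU
  have hlogX : 0 ≤ Real.log X := Real.log_nonneg hX
  have hp1 : 0 ≤ Real.log KU * Real.log X := mul_nonneg hlogKU hlogX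
  have hp2 : 0 ≤ d * Real.log X := mul_nonneg hd hlogX
  have key : 2 * (Real.log KU + d / 2 * Real.log X) + 1
      ≤ (2 * (2 + Real.log KU + d / 2) + 1) * (1 + Real.log X) := by nlinarith
  have hlogT : (Nat.log 2 T : ℝ) ≤ 2 * (Real.log KU + d / 2 * Real.log X) := by
    rcases Nat.eq_zero_or_pos T with h0 | hpos
    · rw [h0, Nat.log_zero_right, Nat.cast_zero]; nlinarith
    · have h1 := Literature.NumberTheory.LFunctions.HuxleyZeroDensity.natLog_two_le T hpos
      have h2 : Real.log (T : ℝ) ≤ Real.log (KU * X ^ (d / 2)) := Real.log_le_log (by exact_mod_cast hpos) hT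
      rw [Real.log_mul (by positivity) (by positivity), Real.log_rpow hX0] at h2
      linarith
  linarith

/-- `κ = min(1 − (d/2)(1−η), 2 − (d/2)(2−θ), η + 2/d − 1) > 0` for `2 − 4/d < θ` and `1 − 2/d < η`. [this work] -/
theorem trapKappa_pos {d θ η : ℝ} (hd : 0 < d) (hθ : 2 - 4 / d < θ) (hη : 1 - 2 / d < η) :
    0 < min (1 - d / 2 * (1 - η)) (min (2 - d / 2 * (2 - θ)) (η + 2 / d - 1)) := by
  refine lt_min ?_ (lt_min ?_ (by linarith))
  · have : d / 2 * (1 - η) < d / 2 * (2 / d) := mul_lt_mul_of_pos_left (by linarith) (by positivity)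
    rw [show d / 2 * (2 / d) = 1 by field_simp] at this
    linarith
  · have : d / 2 * (2 - θ) < d / 2 * (4 / d) := mul_lt_mul_of_pos_left (by linarith) (by positivity)
    rw [show d / 2 * (4 / d) = 2 by field_simp; norm_num] at this
    linarith

/-- `(1 + log X)² ≤ c₁ X^κ` from `(log X)² ≤ (c₁/4) X^κ` and `X ≥ 3`. [this work] -/
theorem one_add_log_sq_le {X c κ : ℝ} (hX : 3 ≤ X) (h : Real.log X ^ 2 ≤ c / 4 * X ^ κ) :
    (1 + Real.log X) ^ 2 ≤ c * X ^ κ := by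
  have hlog1 : 1 ≤ Real.log X := by
    rw [Real.le_log_iff_exp_le (by linarith)]
    have := Real.exp_one_lt_d9
    linarith
  nlinarith

/-- The final bookkeeping: `K_f L₁² (X^{2−κ} + D X^{1−κ}) ≤ ε D X₀ log X₀` once `L₁² ≤ c₁ X^κ`,
`X ≤ 2X₀ ≤ 2D/δ` and `2K_f(2/δ + 1)c₁ ≤ ε`. [this work] -/
theorem trapFinal_le {Kf L₁ X κ c₁ δ ε X₀ D : ℝ} (hKf : 0 ≤ Kf) (hX0 : 0 < X) (hδ : 0 < δ) (hε : 0 < ε)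
    (hc₁ : 0 ≤ c₁) (hX₀3 : 3 ≤ X₀) (hD0 : 0 ≤ D) (hδD : δ * X₀ ≤ D) (hX2 : X ≤ 2 * X₀)
    (hlo : L₁ ^ 2 ≤ c₁ * X ^ κ) (hc₁le : 2 * Kf * (2 / δ + 1) * c₁ ≤ ε) :
    Kf * L₁ ^ 2 * (X ^ (2 - κ) + D * X ^ (1 - κ)) ≤ ε * D * (X₀ * Real.log X₀) := by
  set P₁ : ℝ := X ^ (1 - κ) with hP₁
  have hP₁0 : 0 ≤ P₁ := by positivity
  have p6 : X * P₁ = X ^ (2 - κ) := by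
    rw [hP₁, show (2 : ℝ) - κ = 1 + (1 - κ) by ring, Real.rpow_add hX0, Real.rpow_one]
  have hXδ : X ≤ 2 / δ * D := by
    have : X₀ ≤ D / δ := by rw [le_div_iff₀ hδ]; linarith
    calc X ≤ 2 * X₀ := hX2
      _ ≤ 2 * (D / δ) := by linarith
      _ = 2 / δ * D := by ring
  have hP₂le : X ^ (2 - κ) ≤ 2 / δ * D * P₁ := by rw [← p6]; exact mul_le_mul_of_nonneg_right hXδ hP₁0
  have hlogX₀ : 1 ≤ Real.log X₀ := by
    rw [Real.le_log_iff_exp_le (by positivity)]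
    have := Real.exp_one_lt_d9
    linarith
  have h2δ : 0 ≤ 2 / δ + 1 := by positivity
  calc Kf * L₁ ^ 2 * (X ^ (2 - κ) + D * P₁) ≤ Kf * L₁ ^ 2 * ((2 / δ + 1) * D * P₁) := by
        apply mul_le_mul_of_nonneg_left _ (by positivity); linarith [hP₂le]
    _ = Kf * (2 / δ + 1) * D * (L₁ ^ 2 * P₁) := by ring
    _ ≤ Kf * (2 / δ + 1) * D * (c₁ * X) := by
        apply mul_le_mul_of_nonneg_left _ (by positivity)
        calc L₁ ^ 2 * P₁ ≤ c₁ * X ^ κ * P₁ := mul_le_mul_of_nonneg_right hlo hP₁0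
          _ = c₁ * X := by rw [hP₁, mul_assoc, ← Real.rpow_add hX0, add_sub_cancel, Real.rpow_one]
    _ ≤ Kf * (2 / δ + 1) * D * (c₁ * (2 * X₀)) := by
        apply mul_le_mul_of_nonneg_left _ (by positivity)
        exact mul_le_mul_of_nonneg_left hX2 hc₁
    _ = (2 * Kf * (2 / δ + 1) * c₁) * (D * X₀) := by ring
    _ ≤ ε * (D * X₀) := mul_le_mul_of_nonneg_right hc₁le (by positivity)
    _ = ε * D * X₀ * 1 := by ring
    _ ≤ ε * D * X₀ * Real.log X₀ := mul_le_mul_of_nonneg_left hlogX₀ (by positivity)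
    _ = ε * D * (X₀ * Real.log X₀) := by ring

end Summit.Parity.BatemanHorn.Theorems
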